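/-
Copyright (c) 2026 the pub-hodgecm-mathlib formalisation cell (harness21).  Prover seat hodgecm-mathlib-F0P2-p02 (g12), 2026-09-01.  «S3-ram» seeding wave (LEAD F0P3a-plan (g12)
T11-41; desk F0P3a-p06 (g15), rows «B-shift» ∕ «(I)+(L)-ram» census §B item (1) «γ₁-generic»): the Möbius denominators and the `(n, N)` dictionary in the `|c|^k` currency.
-/
import Literature.NumberTheory.Automorphic.MatrixMoebiusShiftLevelGeneric   -- ★ p846817 (this seat): `shift_parameter_facts_of_valued_lt_one`; brings ★ γ₁ `TypeTwoMoebiusShiftValued`, ★ β `ResiduallySkewShiftUnits`, ★ α `MatrixMoebiusShift`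
import HarnessLib

/-!
# The Cayley shift for ANY shift parameter `0 < |c| < 1`: denominators `|det((c∓1)g + (c±1))| = |c|²`, `|(c∓1)u + (c±1)| = |c|`, and the dictionary
# `|disc χ_{φg}|·|c|² = |disc χ_g|`, `|χ_{φg}(φu)|·|c|² = |χ_g(u)|` — the place-generic twin of ★ γ₁ `TypeTwoMoebiusShiftValued` §2–§3

Topic `NumberTheory/Automorphic`; namespace `Literature.NumberTheory.Automorphic.MoebiusShift` (valued-field lemmas).  THEOREMS ONLY (no definition, no instance, no notation, no named
fact, no `sorry`); kernel lane `--supports stmt-HodgeConjecture-24833`.  Cell `pub/hodgecm-mathlib` (D-0151), crux H413; «S3-ram» seeding wave (LEAD F0P3a-plan (g12) T11-41∕T11-44;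
owner∕desk F0P3a-p06 (g15) `F0/P3a/F0P3a-p06/g15/S3RAM-ORGANS.md`; census §B `F0/P2/p02/g12/CENSUS-Iram-sectionB.F0P2p02g12.md` item (1), F0P3-p02 (g16)'s census
`CENSUS-IL-ram` §0.5 «(I-a) = B-shift generic re-currency»).  HONEST LABEL: HC_CM is proved only modulo the 2 remaining named inputs (hLiu418 24832, h413 24833) until rung 0
closes; nothing printed is asserted here.

WHY.  ★ γ₁ (F0P2-p06 (g10)) binds `hc : |c| = exp(−1)` — the INERT uniformiser `ϖ_v` read at `w`.  At a tame-RAMIFIED non-split `w ∣ v` the `σ`-fixed choice is `c := ϖ_v` with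
`|c|_w = exp(−2)`; the proofs of γ₁ §2–§3 use `|c| = exp(−1)` only to trade `exp(−k)` for `|c|^k`, and the residually-skew cofactor layer ★ β (`ResiduallySkewShiftUnits`, F0P3a-p07) is
already stated for `0 < |c| < 1`.  This file restates the denominators and the `(n, N)` dictionary in the `|c|^k` currency under `hc0 : c ≠ 0`, `hc1 : |c| < 1`, `h2 : |2| = 1`.

THE MATHEMATICS.  `K` valued (value group `ℤᵐ⁰`), `σ` an isometric ring endomorphism with `σ c = c`, `g = 1 + cX` with `X` integral.  §1: the cofactors `det(2·1 + (c±1)X)` and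
`2 + y(c±1)` are units (★ β at `t = c ± 1 ≡ ±1`), hence `|det((c−1)g + (c+1))| = |det((c+1)g + (c−1))| = |c|²` and `|(c−1)u + (c+1)| = |(c+1)u + (c−1)| = |c|` for
`u = 1 + cy`.  §2: `|((c+1)² − (c−1)²)²| = |c|²` (`= (4c)²`), and by ★ α `disc_moebius_fin_two` ∕ `eval_charpoly_moebius_fin_two`:
`|disc χ_{φ_c g}| · |c|² = |disc χ_g|` and `|χ_{φ_c g}(φ_c u)| · |c|² = |χ_g(u)|` — the shift divides the discriminant depth and the depth sum by `|c|²` (inert: `N ↦ N−1`,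
`n ↦ n−2`; tame-ramified with `c = ϖ_v`: `N ↦ N−2`, `n ↦ n−4` in `w`-exponents, i.e. one `v`-step).

## References
* [Kottwitz1986] R. E. Kottwitz, *Base change for unit elements of Hecke algebras*, Compositio Math. 60 (1986), §3.
* [Rogawski1990] J. D. Rogawski, *Automorphic Representations of Unitary Groups in Three Variables*, Ann. of Math. Stud. 123 (1990), §4.9 Prop. 4.9.1 (b) p. 55; §3.5–3.6.
* [Flicker1998UnitaryFL] Y. Z. Flicker, *Elementary proof of the fundamental lemma for a unitary group*, Canad. J. Math. 50 (1998), §6.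
* [SerreLocalFields1979] J.-P. Serre, *Local Fields*, GTM 67 (1979), Ch. I §§1–2; Ch. IV §1.
-/

set_option autoImplicit false

noncomputable section

open Matrix Polynomial
open scoped WithZero

namespace Literature.NumberTheory.Automorphic.MoebiusShift

section Generic

variable {K : Type*} [Field K] [Valued K ℤᵐ⁰]

/-! ## §1 The Möbius denominators for `0 < |c| < 1` -/

/-- **The cofactor units, generic shift parameter**: `|det(2·1 + (c±1)X)| = 1` for `X` integral with residually skew trace and residually square discriminant (★ β at
`t = c ± 1 ≡ ±1`; twin of ★ `valued_det_two_smul_one_add_shift_smul_eq_one`). [cite: Kottwitz1986, §3] [cite: SerreLocalFields1979, Ch. I §§1–2] -/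
theorem valued_det_two_smul_one_add_shift_smul_eq_one_of_valued_lt_one (σ : K →+* K) (hσ : ∀ x, Valued.v (σ x) = Valued.v x) (h2 : Valued.v (2 : K) = 1)
    {c : K} (hc0 : c ≠ 0) (hc1 : Valued.v c < 1) {X : Matrix (Fin 2) (Fin 2) K} (hX : ∀ i j, Valued.v (X i j) ≤ 1)
    (hskew : Valued.v (σ X.trace + X.trace) < 1) (hdisc : Valued.v (X.trace ^ 2 - 4 * X.det) < 1) :
    Valued.v (((2 : K) • (1 : Matrix (Fin 2) (Fin 2) K) + (c - 1) • X).det) = 1 ∧ Valued.v (((2 : K) • (1 : Matrix (Fin 2) (Fin 2) K) + (c + 1) • X).det) = 1 := by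
  obtain ⟨-, -, hm, hp, hm1, hp1⟩ := shift_parameter_facts_of_valued_lt_one hc0 hc1
  exact ⟨valued_det_two_smul_one_add_smul_eq_one σ hσ h2 hX hdisc hskew hm.le (Or.inr hm1),
    valued_det_two_smul_one_add_smul_eq_one σ hσ h2 hX hdisc hskew hp.le (Or.inl hp1)⟩

/-- **The scalar cofactor units, generic shift parameter**: `|2 + y(c±1)| = 1` for `y` integral and residually skew (twin of ★ `valued_two_add_shift_mul_eq_one`).
[cite: SerreLocalFields1979, Ch. I §§1–2] -/
theorem valued_two_add_shift_mul_eq_one_of_valued_lt_one (σ : K →+* K) (hσ : ∀ x, Valued.v (σ x) = Valued.v x) (h2 : Valued.v (2 : K) = 1)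
    {c : K} (hc0 : c ≠ 0) (hc1 : Valued.v c < 1) {y : K} (hy : Valued.v y ≤ 1) (hskew : Valued.v (σ y + y) < 1) :
    Valued.v (2 + y * (c - 1)) = 1 ∧ Valued.v (2 + y * (c + 1)) = 1 := by
  obtain ⟨-, -, hm, hp, hm1, hp1⟩ := shift_parameter_facts_of_valued_lt_one hc0 hc1
  exact ⟨valued_two_add_mul_eq_one σ hσ h2 hy hm.le hskew (Or.inr hm1), valued_two_add_mul_eq_one σ hσ h2 hy hp.le hskew (Or.inl hp1)⟩

/-- **The matrix denominators, generic shift parameter**: `|det((c−1)g + (c+1))| = |c|² = |det((c+1)g + (c−1))|` for `g = 1 + cX` with unit cofactors (twin of ★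
`valued_det_shift_denominators`: `exp(−2) ↦ |c|²`). [cite: Kottwitz1986, §3] -/
theorem valued_det_shift_denominators_of_valued_lt_one {c : K} {X : Matrix (Fin 2) (Fin 2) K}
    (hm : Valued.v (((2 : K) • (1 : Matrix (Fin 2) (Fin 2) K) + (c - 1) • X).det) = 1) (hp : Valued.v (((2 : K) • (1 : Matrix (Fin 2) (Fin 2) K) + (c + 1) • X).det) = 1) :
    Valued.v (((c - 1) • ((1 : Matrix (Fin 2) (Fin 2) K) + c • X) + (c + 1) • (1 : Matrix (Fin 2) (Fin 2) K)).det) = Valued.v c ^ 2 ∧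
      Valued.v (((c + 1) • ((1 : Matrix (Fin 2) (Fin 2) K) + c • X) + (c - 1) • (1 : Matrix (Fin 2) (Fin 2) K)).det) = Valued.v c ^ 2 := by
  constructor
  · rw [smul_one_add_smul_add_smul_one X c (c - 1) (c + 1) (by ring), Matrix.det_smul, Fintype.card_fin, map_mul, map_pow, hm, mul_one]
  · rw [smul_one_add_smul_add_smul_one X c (c + 1) (c - 1) (by ring), Matrix.det_smul, Fintype.card_fin, map_mul, map_pow, hp, mul_one]

/-- **The scalar denominators, generic shift parameter**: `|(c−1)u + (c+1)| = |c| = |(c+1)u + (c−1)|` for `u = 1 + cy` with unit cofactors (twin of ★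
`valued_shift_denominators_one`: `exp(−1) ↦ |c|`). [cite: Kottwitz1986, §3] -/
theorem valued_shift_denominators_one_of_valued_lt_one {c y : K}
    (hm : Valued.v (2 + y * (c - 1)) = 1) (hp : Valued.v (2 + y * (c + 1)) = 1) :
    Valued.v ((c - 1) * (1 + c * y) + (c + 1)) = Valued.v c ∧ Valued.v ((c + 1) * (1 + c * y) + (c - 1)) = Valued.v c := by
  constructor
  · rw [show (c - 1) * (1 + c * y) + (c + 1) = c * (2 + y * (c - 1)) by ring, map_mul, hm, mul_one]
  · rw [show (c + 1) * (1 + c * y) + (c - 1) = c * (2 + y * (c + 1)) by ring, map_mul, hp, mul_one]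

/-! ## §2 The dictionary: the shift divides `|disc χ_g|` and `|χ_g(u)|` by `|c|²` -/

/-- `|((c+1)² − (c−1)²)²| = |c|²` (`(c+1)² − (c−1)² = 4c`, `|2| = 1`; twin of ★ `valued_sq_sub_sq_sq`). [cite: Kottwitz1986, §3] -/
theorem valued_sq_sub_sq_sq_of_valued_lt_one (h2 : Valued.v (2 : K) = 1) (c : K) :
    Valued.v (((c + 1) ^ 2 - (c - 1) ^ 2) ^ 2) = Valued.v c ^ 2 := by
  rw [show ((c + 1) ^ 2 - (c - 1) ^ 2) = 2 * 2 * c by ring, map_pow, map_mul, map_mul, h2, one_mul, one_mul]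

/-- **THE DISCRIMINANT DEPTH DROPS BY `|c|²`**: `|disc χ_{φ_c g}| · |c|² = |disc χ_g|` when `|det((c−1)g + (c+1))| = |c|²`, `c ≠ 0` (★ α `disc_moebius_fin_two`; twin of ★
`valued_disc_moebius`, whose inert reading is `N ↦ N − 1`). [cite: Flicker1998UnitaryFL, §6] [cite: Kottwitz1986, §3] -/
theorem valued_disc_moebius_mul_of_valued_lt_one (h2 : Valued.v (2 : K) = 1) {c : K} (hc0 : c ≠ 0) (g : Matrix (Fin 2) (Fin 2) K)
    (hD : Valued.v (((c - 1) • g + (c + 1) • (1 : Matrix (Fin 2) (Fin 2) K)).det) = Valued.v c ^ 2) :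
    Valued.v ((((c + 1) • g + (c - 1) • (1 : Matrix (Fin 2) (Fin 2) K)) * ((c - 1) • g + (c + 1) • (1 : Matrix (Fin 2) (Fin 2) K))⁻¹).trace ^ 2 -
        4 * (((c + 1) • g + (c - 1) • (1 : Matrix (Fin 2) (Fin 2) K)) * ((c - 1) • g + (c + 1) • (1 : Matrix (Fin 2) (Fin 2) K))⁻¹).det) * Valued.v c ^ 2 =
      Valued.v (g.trace ^ 2 - 4 * g.det) := by
  have hvc0 : Valued.v c ≠ 0 := (Valuation.ne_zero_iff _).2 hc0
  have hpow0 : Valued.v c ^ 2 ≠ 0 := pow_ne_zero _ hvc0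
  have hD0 : ((c - 1) • g + (c + 1) • (1 : Matrix (Fin 2) (Fin 2) K)).det ≠ 0 := fun h => by
    rw [h, map_zero] at hD; exact hpow0 hD.symm
  have key := congrArg Valued.v (disc_moebius_fin_two g (c + 1) (c - 1) hD0)
  rw [map_mul, map_mul, map_pow, hD, valued_sq_sub_sq_sq_of_valued_lt_one h2 c] at key
  -- `key : disc' * (|c|²)² = |c|² * disc`; cancel one `|c|²`
  have e : Valued.v ((((c + 1) • g + (c - 1) • (1 : Matrix (Fin 2) (Fin 2) K)) * ((c - 1) • g + (c + 1) • (1 : Matrix (Fin 2) (Fin 2) K))⁻¹).trace ^ 2 -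
        4 * (((c + 1) • g + (c - 1) • (1 : Matrix (Fin 2) (Fin 2) K)) * ((c - 1) • g + (c + 1) • (1 : Matrix (Fin 2) (Fin 2) K))⁻¹).det) * Valued.v c ^ 2 * Valued.v c ^ 2 =
      Valued.v (g.trace ^ 2 - 4 * g.det) * Valued.v c ^ 2 := by
    rw [mul_assoc, ← pow_two, key, mul_comm]
  exact mul_right_cancel₀ hpow0 e

/-- **THE DEPTH SUM DROPS BY `|c|²`**: `|χ_{φ_c g}(φ_c u)| · |c|² = |χ_g(u)|` when `|det((c−1)g + (c+1))| = |c|²` and `|(c−1)u + (c+1)| = |c|`, `c ≠ 0` (★ α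
`eval_charpoly_moebius_fin_two`; twin of ★ `valued_eval_charpoly_moebius`, whose inert reading is `n ↦ n − 2`). [cite: Flicker1998UnitaryFL, §6] [cite: Kottwitz1986, §3] -/
theorem valued_eval_charpoly_moebius_mul_of_valued_lt_one (h2 : Valued.v (2 : K) = 1) {c : K} (hc0 : c ≠ 0) (g : Matrix (Fin 2) (Fin 2) K) (u : K)
    (hD : Valued.v (((c - 1) • g + (c + 1) • (1 : Matrix (Fin 2) (Fin 2) K)).det) = Valued.v c ^ 2)
    (hu : Valued.v ((c - 1) * u + (c + 1)) = Valued.v c) :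
    Valued.v ((((c + 1) • g + (c - 1) • (1 : Matrix (Fin 2) (Fin 2) K)) * ((c - 1) • g + (c + 1) • (1 : Matrix (Fin 2) (Fin 2) K))⁻¹).charpoly.eval
        (((c + 1) * u + (c - 1)) / ((c - 1) * u + (c + 1)))) * Valued.v c ^ 2 = Valued.v (g.charpoly.eval u) := by
  have hvc0 : Valued.v c ≠ 0 := (Valuation.ne_zero_iff _).2 hc0
  have hpow0 : Valued.v c ^ 2 ≠ 0 := pow_ne_zero _ hvc0
  have hD0 : ((c - 1) • g + (c + 1) • (1 : Matrix (Fin 2) (Fin 2) K)).det ≠ 0 := fun h => by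
    rw [h, map_zero] at hD; exact hpow0 hD.symm
  have hu0 : (c - 1) * u + (c + 1) ≠ 0 := fun h => by rw [h, map_zero] at hu; exact hvc0 hu.symm
  have key := congrArg Valued.v (eval_charpoly_moebius_fin_two g (c + 1) (c - 1) u hD0 hu0)
  rw [map_mul, map_mul, map_mul, map_pow, hD, hu, valued_sq_sub_sq_sq_of_valued_lt_one h2 c] at key
  -- `key : χ' * |c|² * |c|² = |c|² * χ`; cancel one `|c|²`
  have e : Valued.v ((((c + 1) • g + (c - 1) • (1 : Matrix (Fin 2) (Fin 2) K)) * ((c - 1) • g + (c + 1) • (1 : Matrix (Fin 2) (Fin 2) K))⁻¹).charpoly.eval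
        (((c + 1) * u + (c - 1)) / ((c - 1) * u + (c + 1)))) * Valued.v c ^ 2 * Valued.v c ^ 2 = Valued.v (g.charpoly.eval u) * Valued.v c ^ 2 := by
    rw [key, mul_comm]
  exact mul_right_cancel₀ hpow0 e

/-- **The residual discriminant of `X`, generic shift parameter**: for `g = 1 + cX`, `disc χ_g = c²·disc χ_X` (★ β `trace_sq_sub_four_det_one_add_smul`), so
`|disc χ_X| < 1 ↔ |disc χ_g| < |c|²` — the hypothesis shape of the cofactor units in the `|c|^k` currency (inert: `|disc χ_g| ≤ exp(−3)`; tame-ramified with `c = ϖ_v`: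
`|disc χ_g|_w ≤ exp(−5)`). [cite: Kottwitz1986, §3] [cite: Rogawski1990, §3.5–3.6] -/
theorem valued_disc_lt_one_iff_of_valued_lt_one {c : K} (hc0 : c ≠ 0) (X : Matrix (Fin 2) (Fin 2) K) :
    Valued.v (X.trace ^ 2 - 4 * X.det) < 1 ↔
      Valued.v (((1 : Matrix (Fin 2) (Fin 2) K) + c • X).trace ^ 2 - 4 * ((1 : Matrix (Fin 2) (Fin 2) K) + c • X).det) < Valued.v c ^ 2 := by
  have hvc0 : Valued.v c ≠ 0 := (Valuation.ne_zero_iff _).2 hc0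
  have hpos : 0 < Valued.v c ^ 2 := pow_pos (zero_lt_iff.2 hvc0) 2
  rw [trace_sq_sub_four_det_one_add_smul, map_mul, map_pow]
  constructor
  · intro h
    calc Valued.v c ^ 2 * Valued.v (X.trace ^ 2 - 4 * X.det) < Valued.v c ^ 2 * 1 := mul_lt_mul_of_pos_left h hpos
      _ = Valued.v c ^ 2 := mul_one _
  · intro h
    by_contra hle
    rw [not_lt] at hle
    have : Valued.v c ^ 2 * 1 ≤ Valued.v c ^ 2 * Valued.v (X.trace ^ 2 - 4 * X.det) := mul_le_mul' le_rfl hle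
    rw [mul_one] at this
    exact absurd (this.trans_lt h) (lt_irrefl _)

end Generic

end Literature.NumberTheory.Automorphic.MoebiusShift

end
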